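import Summits.NavierStokesRegularity.OSWSelfSimilar.SheetNSLineTorusCascadeTailDeficient
import HarnessLib

/-!
# Viscous CLM on the torus (`a = 0`, `σ = 2`): the STATIC-POLE TAIL LEMMA with a deficiency allowance — time-constant lower bounds
# `A j λ^j (1 − ζ_j) ≤ c_j` on finitely many modes over a window propagate to `A k λ^k ≤ c_k` on ALL modes (no recession factor)

HONEST FRAMING (cell ns-blowup GROUP B «PROFILE SEARCH», zone Z3, row Z3-U addendum A-F2; human rulings D-0035/D-0074; Z3-TWIN
lineage): **1-D MODEL (viscous Constantin–Lax–Majda equation on `𝕋`); ODE calculus on Fourier-coefficient families, kernel-checked;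
not Euler, not Navier–Stokes; «violates: none — MODEL».**

OBJECT: `SheetNSLineTorusCascadeTail` (eng-3) and `SheetNSLineTorusCascadeTailDeficient` (this lineage) compare the sine-datum cascade
with the RECEDING pole `A j r^j e^{−νjs}`; a certificate feeding them pays the recession over the window, `e^{νW}`, in its threshold.
HERE the comparison family is STATIC, `m_j = A j λ^j` (no time factor): if the modes `j < k` dominate `m_j(1 − ζ_j)` on `[α, T]` then
`D_k = e^{νk²s} c_k` has `D_k′ ≥ e^{νk²s}·½Σ m_im_j(1−ζ_i)(1−ζ_j) ≥ e^{νk²s} A²λ^k[(k³−k)/12 − kZ]`, whose integral over a window of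
length `τ` is `≥ (1 − e^{−νk²τ})` of its endpoint value; so `c_k(t) ≥ A k λ^k` as soon as `12νk² ≤ A(k² − 1 − 12Z)(1 − e^{−νk²τ})`.
With the telescoping windows `L/(νk(k−1))` (`νk²τ ≥ L`) the uniform condition is the same as in the receding case,
`12ν ≤ A(1 − e^{−L})(1 − (1 + 12Z)/(k₀+1)²)`:

* `staticPole_conv` — `Σ_{i+j=k}(A i λ^i)(A j λ^j) = (A²/6)(k³ − k)λ^k`;
* `tail_step_static` — one mode; `tail_induction_static` — all modes `k > k₀` on `[α + L/(νk₀), T]`;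
* `unbounded_of_base_static` — if moreover `α + L/(νk₀) ≤ T` and `1 ≤ λ` then `k ↦ c_k(t)` is unbounded for EVERY `t ∈ [α + L/(νk₀), T]`.
READING: this is the exact kernel counterpart of step (Z)+(E) of the Z3-TWIN certificate's Theorem B (`HOME/profile/z3twin/engine/cascade/
README-CERT.md`): the script supplies time-constant certified lower bounds `l_j ≤ c_j` on `J = [T − W, T]`, `j ≤ K₁`, for the datum-`c`
cascade (`l_j = c^j·l̂_j μ₀^j` from the normalised table); with `λ` such that `A j λ^j(1−ζ_j) ≤ l_j` the theorem gives unbounded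
coefficients at time `T` whenever `λ ≥ 1` — i.e. for `c ≥ 1/(λ̂ μ₀)` with NO `e^{νW}` loss, so the script's tightest number
(`19.7766876 ν`, K₁ = 6000) becomes «certified-by-script datum + kernel closing theorem».
bears_on: LADDER-NS N5 / zone Z3 (row Z3-U) → N1 linear core. WHAT THIS IS NOT: not NS; no number certified by THIS file; no definitions.
-/

namespace Summit.NavierStokesRegularity.OSWSelfSimilar
namespace SheetNSLineTorusCascade

open Finset Real Set

variable {ν c : ℝ} {e : ℕ → ℝ → ℝ}

/-- Convolution of the static pole profile `A j λ^j`: `Σ_{i+j=k} (A i λ^i)(A j λ^j) = (A²/6)(k³ − k) λ^k`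
(`generalPole_conv` at `s = 0`). [new here — MODEL] -/
theorem staticPole_conv (A lam : ℝ) (k : ℕ) :
    ∑ p ∈ antidiagonal k, (A * (p.1 : ℝ) * lam ^ p.1) * (A * (p.2 : ℝ) * lam ^ p.2)
      = A ^ 2 / 6 * ((k : ℝ) ^ 3 - k) * lam ^ k := by
  have h := generalPole_conv 0 A lam k 0
  simp only [zero_mul, neg_zero, exp_zero, mul_one] at h
  exact h

/-- **STATIC TAIL STEP WITH DEFICIENCIES.** Let `k ≥ 2`, `0 ≤ α`, `0 < τ`, `0 < A`, `0 ≤ λ`, deficiencies `0 ≤ ζ_j ≤ 1` with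
`Σ_{j ≤ k} j ζ_j ≤ Z`, `12 Z ≤ k² − 1`, and `12νk² ≤ A(k² − 1 − 12Z)(1 − e^{−νk²τ})`. If every mode `j < k` satisfies
`A j λ^j (1 − ζ_j) ≤ e_j(s)` for `s ∈ [α, T]`, then `A k λ^k ≤ e_k(t)` for `t ∈ [α + τ, T]`. [new here — MODEL] -/
theorem tail_step_static (he : IsSineCascade ν c e) (hν : 0 < ν) (hc : 0 ≤ c) {A lam α T τ Z : ℝ} (hA : 0 < A) (hlam : 0 ≤ lam)
    (hα : 0 ≤ α) (hτ : 0 < τ) {k : ℕ} (hk : 2 ≤ k) (ζ : ℕ → ℝ) (hζ0 : ∀ j, 0 ≤ ζ j) (hζ1 : ∀ j, ζ j ≤ 1)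
    (hZ : ∑ j ∈ range (k + 1), (j : ℝ) * ζ j ≤ Z) (hZk : 12 * Z ≤ (k : ℝ) ^ 2 - 1)
    (hcond : 12 * ν * (k : ℝ) ^ 2 ≤ A * ((k : ℝ) ^ 2 - 1 - 12 * Z) * (1 - exp (-(ν * (k : ℝ) ^ 2 * τ))))
    (hyp : ∀ j, j < k → ∀ s ∈ Icc α T, A * (j : ℝ) * lam ^ j * (1 - ζ j) ≤ e j s) :
    ∀ t ∈ Icc (α + τ) T, A * (k : ℝ) * lam ^ k ≤ e k t := by
  intro t ht
  have hk1 : (1 : ℝ) < k := by exact_mod_cast hk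
  have hkpos : (0 : ℝ) < k := by linarith
  have hk2pos : 0 < (k : ℝ) ^ 2 := by positivity
  have hαt : α < t := by linarith [ht.1]
  have htT : t ≤ T := ht.2
  have hZ0 : 0 ≤ Z := le_trans (sum_nonneg fun j _ => mul_nonneg (by positivity) (hζ0 j)) hZ
  -- B := A² λ^k (k² − 1 − 12Z) / (12 ν k) ≥ 0 ;  G(s) = B e^{νk²s}
  set B : ℝ := A ^ 2 * lam ^ k * ((k : ℝ) ^ 2 - 1 - 12 * Z) / (12 * ν * (k : ℝ)) with hB
  have hB0 : 0 ≤ B := by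
    rw [hB]
    apply div_nonneg
    · have : 0 ≤ (k : ℝ) ^ 2 - 1 - 12 * Z := by linarith
      positivity
    · positivity
  set G : ℝ → ℝ := fun s => B * exp (ν * (k : ℝ) ^ 2 * s) with hG
  have hG' : ∀ s, HasDerivAt G (B * (exp (ν * (k : ℝ) ^ 2 * s) * (ν * (k : ℝ) ^ 2))) s := by
    intro s
    have := ((hasDerivAt_id s).const_mul (ν * (k : ℝ) ^ 2)).exp.const_mul B
    simpa using this
  -- the deficient convolution lower bound (static): Σ e_i e_j ≥ A² λ^k ((k³−k)/6 − 2kZ)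
  have hconv : ∀ s, α < s → s ≤ T →
      A ^ 2 * lam ^ k * (((k : ℝ) ^ 3 - k) / 6 - 2 * (k : ℝ) * Z) ≤ ∑ p ∈ antidiagonal k, e p.1 s * e p.2 s := by
    intro s hs hsT
    have hterm : ∀ p ∈ antidiagonal k,
        (A * (p.1 : ℝ) * lam ^ p.1) * (A * (p.2 : ℝ) * lam ^ p.2) * (1 - ζ p.1 - ζ p.2) ≤ e p.1 s * e p.2 s := by
      intro p hp
      have hsum : p.1 + p.2 = k := mem_antidiagonal.mp hp
      set m1 : ℝ := A * (p.1 : ℝ) * lam ^ p.1 with hm1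
      set m2 : ℝ := A * (p.2 : ℝ) * lam ^ p.2 with hm2
      have hm10 : 0 ≤ m1 := by positivity
      have hm20 : 0 ≤ m2 := by positivity
      have hz1 := hζ0 p.1; have hz2 := hζ0 p.2; have hz1' := hζ1 p.1; have hz2' := hζ1 p.2
      have hdef : m1 * m2 * (1 - ζ p.1 - ζ p.2) ≤ (m1 * (1 - ζ p.1)) * (m2 * (1 - ζ p.2)) := by
        have : 0 ≤ m1 * m2 * (ζ p.1 * ζ p.2) := by positivity
        nlinarith
      refine le_trans hdef ?_
      rcases Nat.eq_zero_or_pos p.1 with h1 | h1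
      · have : m1 = 0 := by rw [hm1, h1]; simp
        rw [this, h1, he.zero]; simp
      rcases Nat.eq_zero_or_pos p.2 with h2 | h2
      · have : m2 = 0 := by rw [hm2, h2]; simp
        rw [this, h2, he.zero]; simp
      have ha := hyp p.1 (by omega) s ⟨hs.le, hsT⟩
      have hb := hyp p.2 (by omega) s ⟨hs.le, hsT⟩
      have ha0 : 0 ≤ m1 * (1 - ζ p.1) := mul_nonneg hm10 (by linarith)
      exact mul_le_mul ha hb (mul_nonneg hm20 (by linarith)) (le_trans ha0 ha)
    have hsumid : ∑ p ∈ antidiagonal k, (A * (p.1 : ℝ) * lam ^ p.1) * (A * (p.2 : ℝ) * lam ^ p.2) * (1 - ζ p.1 - ζ p.2)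
        = A ^ 2 / 6 * ((k : ℝ) ^ 3 - k) * lam ^ k
          - A ^ 2 * lam ^ k * ∑ p ∈ antidiagonal k, (p.1 : ℝ) * (p.2 : ℝ) * (ζ p.1 + ζ p.2) := by
      rw [← staticPole_conv A lam k, mul_sum, ← sum_sub_distrib]
      refine sum_congr rfl fun p hp => ?_
      have hsum : p.1 + p.2 = k := mem_antidiagonal.mp hp
      have hrr : lam ^ p.1 * lam ^ p.2 = lam ^ k := by rw [← pow_add, hsum]
      have hprod : (A * (p.1 : ℝ) * lam ^ p.1) * (A * (p.2 : ℝ) * lam ^ p.2) = A ^ 2 * lam ^ k * ((p.1 : ℝ) * (p.2 : ℝ)) := by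
        calc (A * (p.1 : ℝ) * lam ^ p.1) * (A * (p.2 : ℝ) * lam ^ p.2)
            = A ^ 2 * (lam ^ p.1 * lam ^ p.2) * ((p.1 : ℝ) * (p.2 : ℝ)) := by ring
          _ = A ^ 2 * lam ^ k * ((p.1 : ℝ) * (p.2 : ℝ)) := by rw [hrr]
      rw [hprod]; ring
    have hdefect := antidiagonal_defect_le ζ hζ0 k hZ
    have hpos : 0 ≤ A ^ 2 * lam ^ k := by positivity
    calc A ^ 2 * lam ^ k * (((k : ℝ) ^ 3 - k) / 6 - 2 * (k : ℝ) * Z)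
        = A ^ 2 / 6 * ((k : ℝ) ^ 3 - k) * lam ^ k - A ^ 2 * lam ^ k * (2 * (k : ℝ) * Z) := by ring
      _ ≤ A ^ 2 / 6 * ((k : ℝ) ^ 3 - k) * lam ^ k
            - A ^ 2 * lam ^ k * ∑ p ∈ antidiagonal k, (p.1 : ℝ) * (p.2 : ℝ) * (ζ p.1 + ζ p.2) := by
          linarith [mul_le_mul_of_nonneg_left hdefect hpos]
      _ = ∑ p ∈ antidiagonal k, (A * (p.1 : ℝ) * lam ^ p.1) * (A * (p.2 : ℝ) * lam ^ p.2) * (1 - ζ p.1 - ζ p.2) := hsumid.symm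
      _ ≤ ∑ p ∈ antidiagonal k, e p.1 s * e p.2 s := sum_le_sum hterm
  -- G′(s) = e^{νk²s} · ½ · A² λ^k ((k³−k)/6 − 2kZ)
  have hGconv : ∀ s, B * (exp (ν * (k : ℝ) ^ 2 * s) * (ν * (k : ℝ) ^ 2))
      = exp (ν * (k : ℝ) ^ 2 * s) * ((1 / 2) * (A ^ 2 * lam ^ k * (((k : ℝ) ^ 3 - k) / 6 - 2 * (k : ℝ) * Z))) := by
    intro s
    rw [hB]
    have hν0 : ν ≠ 0 := hν.ne'
    have hk0 : (k : ℝ) ≠ 0 := hkpos.ne'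
    field_simp
    ring
  -- φ = D − G non-decreasing on [α, T]
  set D : ℝ → ℝ := fun s => exp (ν * (k : ℝ) ^ 2 * s) * e k s with hD
  have hφmono : MonotoneOn (fun s => D s - G s) (Icc α T) := by
    refine monotoneOn_of_hasDerivWithinAt_nonneg
      (f' := fun s => exp (ν * (k : ℝ) ^ 2 * s) * ((1 / 2) * ∑ p ∈ antidiagonal k, e p.1 s * e p.2 s)
        - B * (exp (ν * (k : ℝ) ^ 2 * s) * (ν * (k : ℝ) ^ 2)))
      (convex_Icc α T) ?_ (fun s hs => ?_) (fun s hs => ?_)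
    · exact ((continuousOn_weighted he k).mono (fun s hs => le_trans hα hs.1)).sub
        ((continuous_const.mul (continuous_exp.comp (continuous_const.mul continuous_id))).continuousOn)
    · rw [interior_Icc] at hs ⊢
      exact ((hasDerivAt_weighted he k (lt_of_le_of_lt hα hs.1)).sub (hG' s)).hasDerivWithinAt
    · rw [interior_Icc] at hs
      rw [hGconv s, ← mul_sub, ← mul_sub]
      refine mul_nonneg (exp_pos _).le (mul_nonneg (by norm_num) ?_)
      rw [sub_nonneg]
      exact hconv s hs.1 hs.2.le
  have hαT : α ≤ T := le_trans hαt.le htT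
  have hDα : 0 ≤ D α := mul_nonneg (exp_pos _).le (nonneg he hc k α hα)
  have hmain : G t - G α ≤ D t := by
    have := hφmono ⟨le_rfl, hαT⟩ ⟨hαt.le, htT⟩ hαt.le
    simp only at this
    linarith
  -- the window: G α ≤ e^{−x} G t with x = νk²τ
  set x : ℝ := ν * (k : ℝ) ^ 2 * τ with hx
  have hwin : G α ≤ exp (-x) * G t := by
    show B * exp (ν * (k : ℝ) ^ 2 * α) ≤ exp (-x) * (B * exp (ν * (k : ℝ) ^ 2 * t))
    have h1 : exp (ν * (k : ℝ) ^ 2 * α) ≤ exp (-x) * exp (ν * (k : ℝ) ^ 2 * t) := by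
      rw [← exp_add]
      apply exp_le_exp.mpr
      have : ν * (k : ℝ) ^ 2 * (t - α) ≥ x := by
        rw [hx]; exact mul_le_mul_of_nonneg_left (by linarith [ht.1]) (by positivity)
      linarith
    nlinarith [hB0, mul_le_mul_of_nonneg_left h1 hB0]
  have hDlow : (1 - exp (-x)) * G t ≤ D t := by nlinarith
  -- conclude: e_k t = e^{−νk²t} D t ≥ (1 − e^{−x}) B ≥ A k λ^k
  have hek : e k t = exp (-(ν * (k : ℝ) ^ 2 * t)) * D t := by
    show e k t = exp (-(ν * (k : ℝ) ^ 2 * t)) * (exp (ν * (k : ℝ) ^ 2 * t) * e k t)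
    rw [← mul_assoc, ← exp_add]; simp
  rw [hek]
  have hE : 0 < exp (-(ν * (k : ℝ) ^ 2 * t)) := exp_pos _
  have hstep2 : exp (-(ν * (k : ℝ) ^ 2 * t)) * ((1 - exp (-x)) * G t)
      ≤ exp (-(ν * (k : ℝ) ^ 2 * t)) * D t := mul_le_mul_of_nonneg_left hDlow hE.le
  refine le_trans ?_ hstep2
  have hGt : G t = B * exp (ν * (k : ℝ) ^ 2 * t) := rfl
  rw [hGt, hB]
  have hlk : 0 ≤ lam ^ k := pow_nonneg hlam k
  have hν0 : ν ≠ 0 := hν.ne'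
  have key : A * (k : ℝ) * lam ^ k ≤ (1 - exp (-x)) * (A ^ 2 * lam ^ k * ((k : ℝ) ^ 2 - 1 - 12 * Z) / (12 * ν * (k : ℝ))) := by
    rw [hx]
    have h1 : A * (k : ℝ) * lam ^ k * (12 * ν * (k : ℝ))
        ≤ (1 - exp (-(ν * (k : ℝ) ^ 2 * τ))) * (A ^ 2 * lam ^ k * ((k : ℝ) ^ 2 - 1 - 12 * Z)) := by
      have := mul_le_mul_of_nonneg_left hcond (mul_nonneg hA.le hlk)
      nlinarith
    rw [← mul_div_assoc, le_div_iff₀ (by positivity)]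
    linarith
  have hEE : exp (-(ν * (k : ℝ) ^ 2 * t)) * exp (ν * (k : ℝ) ^ 2 * t) = 1 := by
    rw [← exp_add]; simp
  calc A * (k : ℝ) * lam ^ k
      = (exp (-(ν * (k : ℝ) ^ 2 * t)) * exp (ν * (k : ℝ) ^ 2 * t)) * (A * (k : ℝ) * lam ^ k) := by rw [hEE, one_mul]
    _ ≤ (exp (-(ν * (k : ℝ) ^ 2 * t)) * exp (ν * (k : ℝ) ^ 2 * t))
          * ((1 - exp (-x)) * (A ^ 2 * lam ^ k * ((k : ℝ) ^ 2 - 1 - 12 * Z) / (12 * ν * (k : ℝ)))) :=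
        mul_le_mul_of_nonneg_left key (by positivity)
    _ = exp (-(ν * (k : ℝ) ^ 2 * t)) * ((1 - exp (-x)) * (A ^ 2 * lam ^ k * ((k : ℝ) ^ 2 - 1 - 12 * Z)
          / (12 * ν * (k : ℝ)) * exp (ν * (k : ℝ) ^ 2 * t))) := by ring

/-- **STATIC TAIL INDUCTION WITH DEFICIENCIES.** Let `0 < L`, `0 < A`, `0 ≤ λ`, `0 ≤ α`, `1 ≤ k₀`, deficiencies `0 ≤ ζ_j ≤ 1` with
`ζ_j = 0` for `j > k₀` and `Σ_{j ≤ n} j ζ_j ≤ Z` for every `n`, `1 + 12Z ≤ (k₀+1)²`, and `12ν ≤ A(1 − e^{−L})(1 − (1 + 12Z)/(k₀+1)²)`.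
If the modes `j ≤ k₀` satisfy `A j λ^j (1 − ζ_j) ≤ e_j(s)` on `[α, T]`, then every mode `k > k₀` satisfies `A k λ^k ≤ e_k(t)` on
`[α + L/(νk₀), T]`. [new here — MODEL] -/
theorem tail_induction_static (he : IsSineCascade ν c e) (hν : 0 < ν) (hc : 0 ≤ c) {A lam α T L Z : ℝ} (hA : 0 < A) (hlam : 0 ≤ lam)
    (hα : 0 ≤ α) (hL : 0 < L) {k₀ : ℕ} (hk₀ : 1 ≤ k₀) (ζ : ℕ → ℝ) (hζ0 : ∀ j, 0 ≤ ζ j) (hζ1 : ∀ j, ζ j ≤ 1)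
    (hζsupp : ∀ j, k₀ < j → ζ j = 0) (hZ : ∀ n, ∑ j ∈ range (n + 1), (j : ℝ) * ζ j ≤ Z)
    (hZk : 1 + 12 * Z ≤ ((k₀ : ℝ) + 1) ^ 2)
    (hAL : 12 * ν ≤ A * (1 - exp (-L)) * (1 - (1 + 12 * Z) / ((k₀ : ℝ) + 1) ^ 2))
    (base : ∀ j, j ≤ k₀ → ∀ s ∈ Icc α T, A * (j : ℝ) * lam ^ j * (1 - ζ j) ≤ e j s) :
    ∀ k : ℕ, k₀ < k → ∀ t ∈ Icc (α + L / (ν * (k₀ : ℝ))) T, A * (k : ℝ) * lam ^ k ≤ e k t := by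
  have hk₀pos : (0 : ℝ) < k₀ := by exact_mod_cast hk₀
  have hZ0 : 0 ≤ Z := le_trans (by simp) (hZ 0)
  have h1eL : 0 ≤ 1 - exp (-L) := by
    have : exp (-L) ≤ 1 := exp_le_one_iff.mpr (by linarith)
    linarith
  have P : ∀ k : ℕ, k₀ ≤ k → ∀ j, j ≤ k → ∀ s ∈ Icc (α + L / ν * (1 / (k₀ : ℝ) - 1 / (k : ℝ))) T,
      A * (j : ℝ) * lam ^ j * (1 - ζ j) ≤ e j s := by
    intro k hk
    induction k, hk using Nat.le_induction with
    | base =>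
      intro j hj s hs
      refine base j hj s ⟨?_, hs.2⟩
      have : α + L / ν * (1 / (k₀ : ℝ) - 1 / (k₀ : ℝ)) = α := by ring
      linarith [hs.1]
    | succ n hn ih =>
      intro j hj s hs
      have hnpos : (0 : ℝ) < n := by exact_mod_cast (lt_of_lt_of_le (by omega : 0 < k₀) hn)
      have hτ : 0 < L / (ν * ((n : ℝ) + 1) * (n : ℝ)) := by positivity
      have hstep : α + L / ν * (1 / (k₀ : ℝ) - 1 / ((n + 1 : ℕ) : ℝ))
          = (α + L / ν * (1 / (k₀ : ℝ) - 1 / (n : ℝ))) + L / (ν * ((n : ℝ) + 1) * (n : ℝ)) := by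
        have hν0 : ν ≠ 0 := hν.ne'
        have hn0 : (n : ℝ) ≠ 0 := hnpos.ne'
        push_cast
        field_simp
        ring
      rcases Nat.lt_or_ge j (n + 1) with hlt | hge
      · refine ih j (by omega) s ⟨?_, hs.2⟩
        rw [hstep] at hs
        linarith [hs.1, hτ.le]
      · have hjn : j = n + 1 := le_antisymm hj hge
        subst hjn
        have hαn : 0 ≤ α + L / ν * (1 / (k₀ : ℝ) - 1 / (n : ℝ)) := by
          have h1 : 1 / (n : ℝ) ≤ 1 / (k₀ : ℝ) := one_div_le_one_div_of_le hk₀pos (by exact_mod_cast hn)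
          have h2 : 0 ≤ L / ν := div_nonneg hL.le hν.le
          nlinarith
        have hk2 : 2 ≤ n + 1 := by omega
        set kk : ℝ := ((n + 1 : ℕ) : ℝ) with hkk_def
        have hkk1 : ((k₀ : ℝ) + 1) ≤ kk := by rw [hkk_def]; push_cast; exact_mod_cast Nat.succ_le_succ hn
        have hkk0 : 0 < kk := by linarith
        have hZk' : 12 * Z ≤ kk ^ 2 - 1 := by nlinarith
        -- ν kk² τ = L (n+1)/n ≥ L
        have hxL : L ≤ ν * kk ^ 2 * (L / (ν * ((n : ℝ) + 1) * (n : ℝ))) := by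
          have hν0 : ν ≠ 0 := hν.ne'
          have hn0 : (n : ℝ) ≠ 0 := hnpos.ne'
          have hid : ν * kk ^ 2 * (L / (ν * ((n : ℝ) + 1) * (n : ℝ))) = L * (((n : ℝ) + 1) / (n : ℝ)) := by
            rw [hkk_def]; push_cast
            field_simp
          rw [hid]
          have hge1 : 1 ≤ ((n : ℝ) + 1) / (n : ℝ) := by
            rw [le_div_iff₀ hnpos]; linarith
          nlinarith
        have hcond : 12 * ν * kk ^ 2 ≤ A * (kk ^ 2 - 1 - 12 * Z) * (1 - exp (-(ν * kk ^ 2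
            * (L / (ν * ((n : ℝ) + 1) * (n : ℝ)))))) := by
          have hc0 : (1 - (1 + 12 * Z) / ((k₀ : ℝ) + 1) ^ 2) * kk ^ 2 ≤ kk ^ 2 - 1 - 12 * Z := by
            have hpos : (0 : ℝ) < ((k₀ : ℝ) + 1) ^ 2 := by positivity
            have hsq : ((k₀ : ℝ) + 1) ^ 2 ≤ kk ^ 2 := pow_le_pow_left₀ (by positivity) hkk1 2
            have hge1 : 1 ≤ kk ^ 2 / ((k₀ : ℝ) + 1) ^ 2 := by rw [le_div_iff₀ hpos]; linarith
            have hfrac : 1 + 12 * Z ≤ (1 + 12 * Z) / ((k₀ : ℝ) + 1) ^ 2 * kk ^ 2 := by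
              have hre : (1 + 12 * Z) / ((k₀ : ℝ) + 1) ^ 2 * kk ^ 2 = (1 + 12 * Z) * (kk ^ 2 / ((k₀ : ℝ) + 1) ^ 2) := by
                ring
              rw [hre]
              have h12Z : 0 ≤ 1 + 12 * Z := by linarith
              nlinarith
            nlinarith
          -- 1 − e^{−x} ≥ 1 − e^{−L}
          have hexp : 1 - exp (-L) ≤ 1 - exp (-(ν * kk ^ 2 * (L / (ν * ((n : ℝ) + 1) * (n : ℝ))))) := by
            have := exp_le_exp.mpr (neg_le_neg hxL)
            linarith
          have hK0 : 0 ≤ kk ^ 2 - 1 - 12 * Z := by linarith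
          have h3 : 12 * ν * kk ^ 2 ≤ A * (1 - exp (-L)) * (1 - (1 + 12 * Z) / ((k₀ : ℝ) + 1) ^ 2) * kk ^ 2 :=
            mul_le_mul_of_nonneg_right hAL (by positivity)
          have h4 : A * (1 - exp (-L)) * (1 - (1 + 12 * Z) / ((k₀ : ℝ) + 1) ^ 2) * kk ^ 2
              ≤ A * (1 - exp (-L)) * (kk ^ 2 - 1 - 12 * Z) := by
            have := mul_le_mul_of_nonneg_left hc0 (mul_nonneg hA.le h1eL)
            linarith
          have h5 : A * (1 - exp (-L)) * (kk ^ 2 - 1 - 12 * Z)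
              ≤ A * (1 - exp (-(ν * kk ^ 2 * (L / (ν * ((n : ℝ) + 1) * (n : ℝ)))))) * (kk ^ 2 - 1 - 12 * Z) := by
            have := mul_le_mul_of_nonneg_left hexp (mul_nonneg hA.le hK0)
            nlinarith
          calc 12 * ν * kk ^ 2 ≤ A * (1 - exp (-L)) * (1 - (1 + 12 * Z) / ((k₀ : ℝ) + 1) ^ 2) * kk ^ 2 := h3
            _ ≤ A * (1 - exp (-L)) * (kk ^ 2 - 1 - 12 * Z) := h4
            _ ≤ A * (1 - exp (-(ν * kk ^ 2 * (L / (ν * ((n : ℝ) + 1) * (n : ℝ)))))) * (kk ^ 2 - 1 - 12 * Z) := h5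
            _ = A * (kk ^ 2 - 1 - 12 * Z) * (1 - exp (-(ν * kk ^ 2 * (L / (ν * ((n : ℝ) + 1) * (n : ℝ)))))) := by ring
        have hres := tail_step_static he hν hc hA hlam hαn hτ hk2 ζ hζ0 hζ1 (hZ (n + 1)) hZk' hcond
          (fun i hi s' hs' => ih i (by omega) s' hs') s (by rw [hstep] at hs; exact hs)
        rw [hζsupp (n + 1) (by omega), sub_zero, mul_one]
        exact hres
  intro k hk t ht
  have hres := P k hk.le k le_rfl t ⟨?_, ht.2⟩
  · rw [hζsupp k hk, sub_zero, mul_one] at hres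
    exact hres
  · have hkpos : (0 : ℝ) < k := by exact_mod_cast (lt_of_lt_of_le (by omega : 0 < k₀) hk.le)
    have h1 : L / ν * (1 / (k₀ : ℝ) - 1 / (k : ℝ)) ≤ L / (ν * (k₀ : ℝ)) := by
      have hν0 : ν ≠ 0 := hν.ne'
      have hk0' : (k₀ : ℝ) ≠ 0 := hk₀pos.ne'
      have hk' : (k : ℝ) ≠ 0 := hkpos.ne'
      have e1 : L / ν * (1 / (k₀ : ℝ) - 1 / (k : ℝ)) = L / (ν * (k₀ : ℝ)) - L / (ν * (k : ℝ)) := by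
        field_simp
      have e2 : 0 ≤ L / (ν * (k : ℝ)) := by positivity
      linarith
    linarith [ht.1]

/-- **BLOW-UP FROM A CERTIFIED STATIC BASE.** Under the hypotheses of `tail_induction_static`, if `α + L/(νk₀) ≤ T` and `1 ≤ λ`,
then for EVERY `t ∈ [α + L/(νk₀), T]` the sequence `k ↦ c_k(t)` is unbounded (`c_k(t) ≥ A k` for `k > k₀`): no solution with bounded
Fourier coefficients survives to `α + L/(νk₀)` — with NO recession factor in the threshold. [new here — MODEL] -/
theorem unbounded_of_base_static (he : IsSineCascade ν c e) (hν : 0 < ν) (hc : 0 ≤ c) {A lam α T L Z : ℝ} (hA : 0 < A)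
    (hlam : 0 ≤ lam) (hα : 0 ≤ α) (hL : 0 < L) {k₀ : ℕ} (hk₀ : 1 ≤ k₀) (ζ : ℕ → ℝ) (hζ0 : ∀ j, 0 ≤ ζ j) (hζ1 : ∀ j, ζ j ≤ 1)
    (hζsupp : ∀ j, k₀ < j → ζ j = 0) (hZ : ∀ n, ∑ j ∈ range (n + 1), (j : ℝ) * ζ j ≤ Z)
    (hZk : 1 + 12 * Z ≤ ((k₀ : ℝ) + 1) ^ 2)
    (hAL : 12 * ν ≤ A * (1 - exp (-L)) * (1 - (1 + 12 * Z) / ((k₀ : ℝ) + 1) ^ 2))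
    (base : ∀ j, j ≤ k₀ → ∀ s ∈ Icc α T, A * (j : ℝ) * lam ^ j * (1 - ζ j) ≤ e j s)
    (hlam1 : 1 ≤ lam) {t : ℝ} (ht : t ∈ Icc (α + L / (ν * (k₀ : ℝ))) T) :
    ∀ M : ℝ, ∃ k : ℕ, M < e k t := by
  intro M
  obtain ⟨k, hk⟩ := exists_nat_gt (max (M / A) (k₀ : ℝ))
  have hkM : M / A < k := lt_of_le_of_lt (le_max_left _ _) hk
  have hkk₀ : k₀ < k := by
    have : (k₀ : ℝ) < k := lt_of_le_of_lt (le_max_right _ _) hk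
    exact_mod_cast this
  refine ⟨k, lt_of_lt_of_le ?_
    (tail_induction_static he hν hc hA hlam hα hL hk₀ ζ hζ0 hζ1 hζsupp hZ hZk hAL base k hkk₀ t ht)⟩
  have hq : (1 : ℝ) ≤ lam ^ k := one_le_pow₀ hlam1
  have hM : M < A * (k : ℝ) := by rw [div_lt_iff₀ hA] at hkM; linarith
  nlinarith [mul_le_mul_of_nonneg_left hq (by positivity : (0:ℝ) ≤ A * (k : ℝ))]

end SheetNSLineTorusCascade
end Summit.NavierStokesRegularity.OSWSelfSimilar
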